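import Mathlib
import HarnessLib

/-!
# Sections of smooth morphisms over complete local rings through a rational point

Stub `exists_section_of_smooth` of the line `strata-split` for the crux `EquisingularLift`
(stmt-ResolutionOfSingularities-15660).

Let `(O, 𝔪, κ)` be a local ring which is `𝔪`-adically complete (and separated), `r₁ : P₁ → Spec O`
a morphism of schemes which is smooth on an open `U ⊆ P₁`, and `x : Spec κ → P₁` a `κ`-point over
`Spec κ → Spec O` landing in `U`. Then `x` extends to a section `s : Spec O → P₁` of `r₁`
(Hensel's lemma in scheme form, EGA IV₄ Thm. 18.5.17, there for henselian `O`).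

Proof: the image point of `x` has an affine open neighbourhood `V ⊆ U`; `A = Γ(P₁, V)` is a smooth,
hence formally smooth, `O`-algebra (`AlgebraicGeometry.Smooth.smooth_appLE`), and `x` is `Spec` of
an `O`-algebra map `u : A → κ = O/𝔪`. A formally smooth `O`-algebra map into `O/𝔪` lifts to `O`
when `O` is `𝔪`-adically complete (Mathlib's
`Algebra.FormallySmooth.exists_mkₐ_comp_eq_of_isAdicComplete`), giving `v : A →ₐ[O] O`, and
`s = Spec v ≫ (V ↪ P₁)`. The identities `s ≫ r₁ = 𝟙` and `Spec (O → κ) ≫ s = x` are checked on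
`Spec` of ring maps (`Spec` is fully faithful), via the naturality square
`IsAffineOpen.SpecMap_appLE_fromSpec`.

References: A. Grothendieck, J. Dieudonné, *EGA IV₄*, Publ. Math. IHÉS 32 (1967), 18.5.17;
H. Matsumura, *Commutative Ring Theory*, CUP 1986, proof of Thm. 29.2 (successive lifting).
-/

set_option linter.dupNamespace false -- mandated namespace of this single-conjunct summit

namespace Summit.ResolutionOfSingularities.ResolutionOfSingularities.Cruxes.EquisingularLift.StrataSplit

open CategoryTheory AlgebraicGeometry TopologicalSpace
open IsLocalRing

universe u

/-- **Hensel's lemma for smooth morphisms (affine-local form).** Let `O` be a local ring, complete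
and separated for the `𝔪`-adic topology, `f : P → Spec O` a smooth morphism and
`x : Spec κ → P` a point of `P` with values in the residue field `κ = O/𝔪`, compatible with
`Spec κ → Spec O`. Then there is a section `s : Spec O → P` of `f` restricting to `x` on `Spec κ`.
[cite: Grothendieck1967, Thm. 18.5.17] -/
theorem exists_section_of_smooth_of_isAdicComplete (O : Type u) [CommRing O] [IsLocalRing O]
    [IsAdicComplete (maximalIdeal O) O] {P : Scheme.{u}} (f : P ⟶ Spec (.of O)) [Smooth f]
    (x : Spec (.of (ResidueField O)) ⟶ P)
    (hx : x ≫ f = Spec.map (CommRingCat.ofHom (residue O))) :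
    ∃ s : Spec (.of O) ⟶ P, s ≫ f = 𝟙 _ ∧ Spec.map (CommRingCat.ofHom (residue O)) ≫ s = x := by
  -- an affine open neighbourhood `V` of the image of the unique point of `Spec κ`
  obtain ⟨V, hV, hxV, -⟩ :=
    exists_isAffineOpen_mem_and_subset (X := P) (x := x default) (U := ⊤) trivial
  have hrange : Set.range x ⊆ Set.range V.ι := by
    rw [Scheme.Opens.range_ι]
    rintro _ ⟨p, rfl⟩
    rw [Unique.eq_default p]
    exact hxV
  -- `x` factors through `V ≅ Spec Γ(P, V)`, i.e. is `Spec` of a ring map `u₀ : Γ(P, V) → κ`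
  obtain ⟨xV, hxVι⟩ : ∃ xV : Spec (.of (ResidueField O)) ⟶ V, xV ≫ V.ι = x :=
    ⟨_, IsOpenImmersion.lift_fac V.ι x hrange⟩
  obtain ⟨u₀, hu₀⟩ : ∃ u₀ : Γ(P, V) ⟶ CommRingCat.of (ResidueField O),
      Spec.map u₀ = xV ≫ hV.isoSpec.hom := Spec.map_surjective _
  have hxu₀ : Spec.map u₀ ≫ hV.fromSpec = x := by
    rw [hu₀, Category.assoc, IsAffineOpen.isoSpec_hom_fromSpec, hxVι]
  -- `Γ(P, V)` is a smooth `O`-algebra via `φ`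
  let φ : O →+* Γ(P, V) := (f.appLE ⊤ V le_top).hom.comp (Scheme.ΓSpecIso (.of O)).inv.hom
  have hφ : φ.Smooth :=
    RingHom.Smooth.comp (RingHom.Smooth.of_bijective
      (Scheme.ΓSpecIso (.of O)).commRingCatIsoToRingEquiv.symm.bijective)
      (f.smooth_appLE (isAffineOpen_top _) hV le_top)
  letI : Algebra O Γ(P, V) := φ.toAlgebra
  haveI : Algebra.Smooth O Γ(P, V) := hφ
  -- `Spec Γ(P, V) → P → Spec O` is `Spec φ`
  have hfromSpec : hV.fromSpec ≫ f = Spec.map (CommRingCat.ofHom φ) := by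
    rw [← IsAffineOpen.SpecMap_appLE_fromSpec f (isAffineOpen_top _) hV le_top,
      IsAffineOpen.fromSpec_top, Scheme.isoSpec_Spec_inv, ← Spec.map_comp]
    rfl
  -- compatibility: `u₀ ∘ φ` is the residue map, so `u₀` is an `O`-algebra map
  have hcomp : CommRingCat.ofHom φ ≫ u₀ = CommRingCat.ofHom (residue O) := by
    apply Spec.map_injective
    rw [Spec.map_comp, ← hfromSpec, ← Category.assoc, hxu₀, hx]
  let u : Γ(P, V) →ₐ[O] O ⧸ maximalIdeal O :=
    { u₀.hom with commutes' := fun r => congr(($hcomp).hom r) }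
  -- lift `u` to `v : Γ(P, V) →ₐ[O] O` by formal smoothness and completeness
  obtain ⟨v, hv⟩ := Algebra.FormallySmooth.exists_mkₐ_comp_eq_of_isAdicComplete (R := O) u
  refine ⟨Spec.map (CommRingCat.ofHom v.toRingHom) ≫ hV.fromSpec, ?_, ?_⟩
  · rw [Category.assoc, hfromSpec, ← Spec.map_comp, Spec.map_eq_id]
    ext r
    exact v.commutes r
  · rw [← hxu₀, ← Spec.map_comp_assoc]
    congr 2
    ext a
    exact congr($hv a)

/-- **Sections of a morphism smooth along a rational point of the special fibre.** Let `O` be a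
local ring, complete and separated for the `𝔪`-adic topology, `r₁ : P₁ → Spec O` a morphism,
`U ⊆ P₁` an open on which `r₁` is smooth, and `x : Spec κ → P₁` (`κ = O/𝔪`) a `κ`-point over
`Spec κ → Spec O` with image in `U`. Then `x` extends to a section `s : Spec O → P₁` of `r₁`:
`s ≫ r₁ = 𝟙` and `s` restricts to `x` on `Spec κ` (Hensel's lemma for smooth morphisms over a
complete local ring). [cite: Grothendieck1967, Thm. 18.5.17] -/
theorem exists_section_of_smooth : ∀ (O : Type) [CommRing O] [IsLocalRing O]
    [IsAdicComplete (IsLocalRing.maximalIdeal O) O] (P₁ : AlgebraicGeometry.Scheme.{0})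
    (r₁ : P₁ ⟶ AlgebraicGeometry.Spec (.of O)) (U : P₁.Opens), AlgebraicGeometry.Smooth (U.ι ≫ r₁) →
    ∀ (x : AlgebraicGeometry.Spec (.of (IsLocalRing.ResidueField O)) ⟶ P₁), Set.range x ⊆ (U : Set P₁) →
    x ≫ r₁ = AlgebraicGeometry.Spec.map (CommRingCat.ofHom (IsLocalRing.residue O)) →
    ∃ s : AlgebraicGeometry.Spec (.of O) ⟶ P₁, s ≫ r₁ = 𝟙 _ ∧
      AlgebraicGeometry.Spec.map (CommRingCat.ofHom (IsLocalRing.residue O)) ≫ s = x := by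
  intro O _ _ _ P₁ r₁ U hU x hxU hx
  -- `x` factors through the open subscheme `U`, over which `r₁` is smooth
  have hrange : Set.range x ⊆ Set.range U.ι := by rwa [Scheme.Opens.range_ι]
  obtain ⟨xU, hxUι⟩ : ∃ xU : Spec (.of (ResidueField O)) ⟶ U, xU ≫ U.ι = x :=
    ⟨_, IsOpenImmersion.lift_fac U.ι x hrange⟩
  have hxU' : xU ≫ (U.ι ≫ r₁) = Spec.map (CommRingCat.ofHom (residue O)) := by
    rw [← Category.assoc, hxUι, hx]
  obtain ⟨s, hs, hsx⟩ := exists_section_of_smooth_of_isAdicComplete O (U.ι ≫ r₁) xU hxU'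
  refine ⟨s ≫ U.ι, by rw [Category.assoc, hs], ?_⟩
  rw [← Category.assoc, hsx, hxUι]

end Summit.ResolutionOfSingularities.ResolutionOfSingularities.Cruxes.EquisingularLift.StrataSplit
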